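import Literature.NumberTheory.EllipticCurves.PAdicMeasureTransformBranches
import Literature.NumberTheory.EllipticCurves.PAdicLFunctionInterpolationProofs
import HarnessLib

/-!
# The ODD `ω^i`-branches `L⁻_p(f, α, ω^i, T)` (minus modular symbols) INTERPOLATE at the wild
# characters (proofs only)

Topic `NumberTheory/EllipticCurves`; namespace `Literature.NumberTheory.EllipticCurves`. THEOREMS ONLY
(no definition, no named fact; D-0014, D-0026). The minus twin of
`PAdicLFunctionBranchInterpolationProofs`: `PAdicLFunctionMinus` defines the `ω^i`-branch
`padicLFunctionMinusBranch f α i = ∫_{ℤ_p^×} ω^i(x)(1+T)^{ℓ(x)} dμ⁻_{f,α}` of the MINUS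
Mazur–Swinnerton-Dyer measure `μ⁻(a + pⁿℤ_p) = α⁻ⁿ[a/pⁿ]⁻ − α⁻ⁿ⁻¹[a/pⁿ⁻¹]⁻` (Mazur–Tate–Teitelbaum,
Invent. Math. 84 (1986) §I.10 (10.1), §I.13 — for ODD `i` the odd tame branch `L_p(f, α, ω^i, T)`),
`PAdicLFunctionMinusDistributionProofs` evaluated it at `T = 0`, and `PAdicMeasureTransformBranches`
showed that its coefficients are those of the trivial branch of the twisted bounded distribution
`ω^i μ⁻_{f,α}` (`branchTwist`, `weightedRiemannSum_eq`, `tendsto_padicLMinusBranchRiemannSum`). This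
file records the INTERPOLATION PROPERTY at every wild character (MTT §I.13 "`L_p(P, χψ) = ∫ χψ dμ`",
§I.14 (14.3)): for a character `κ` of `Γ` of level `p^{m+1} ≥ p^{e₀}` (even, `p`-power order),

  `L⁻_p(f, α, ω^i, κ(γ) − 1) = ∑_{a mod p^{m+1}} κ(a) ω(a)^i μ⁻_{f,α}(a + p^{m+1}ℤ_p)`
  (`hasSum_padicLMinusBranchCoeff_mul_pow_of_distribution` — the abstract Mellin transform
  `hasSum_limUnder_riemannSum_mul_pow_of_distribution` applied to `ω^i μ⁻_{f,α}`),

and for `κ` PRIMITIVE of conductor `p^{m+1}`, `m ≥ e₀`, the lower-level term drops out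
(`sum_mul_msdMinusMeasure_mul_teichWeight_succ`; `[a/p^m]⁻` only depends on `a mod p^m`,
`ratMinusSymbol_div_pow_eq_of_castHom`, an unconditional consequence of the tree theorem
`ratMinusSymbol_add_intCast`), whence

  `L⁻_p(f, α, ω^i, κ(γ) − 1) = α^{−(m+1)} ∑_{a mod p^{m+1}} κ(a) ω(a)^i [a/p^{m+1}]⁻_f`
  (`hasSum_padicLMinusBranchCoeff_mul_pow_of_isPrimitive`; MTT §I.14 (14.3) at the ODD character
  `χ = κω^i`: `∑ χ(a)[a/p^{m+1}]⁻ = τ(χ)L(f, χ̄, 1)/(Ω⁻_f·i)` by Birch's formula,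
  `ratMinusTwistedSymbolSum_mul_minusPeriod_mul_I`).

The inputs (distribution relation `hdist`, bound `hC`) are hypotheses here; for the newform of an
elliptic curve at a good ordinary prime and its unit root they are the tree's
`sum_fiber_msdMinusMeasure_succ_eq_of_coeffField` / `exists_norm_msdMinusMeasure_le_of_maninDrinfeld`.

Motivation (cell `b2b-bsdres`, sub-cell additive-p2, X3♯(G-ord)/X4♯(G-ord) defect 2 at
`p ≡ 3 (mod 4)`): the dictionary between the E-normalised tame branch of `E = E♭ ⊗ χ_{−p}` and the
odd branch `L_p(f_{E♭}, α, ω^{(p−1)/2}, T)` of its good ordinary twist, at the level of power series.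

What is NOT here: the one-term (multiplicative, `p ∣ N`) minus measure `msdMinusMeasureMult`; Birch's
formula; anything at `p = 2` beyond the generic statements.

References: B. Mazur, J. Tate, J. Teitelbaum, Invent. Math. 84 (1986) §I.8 (8.6), §I.10 (10.1),
§I.11, §I.13, §I.14 (14.3) [MazurTateTeitelbaum1986Invent]; L. C. Washington, GTM 83, §7.2, §12.2
[Washington1997].
-/

noncomputable section

open Filter Topology

open scoped MatrixGroups ModularForm

namespace Literature.NumberTheory.EllipticCurves

open CongruenceSubgroup Literature.NumberTheory.EllipticCurves.ModularForms

variable {p : ℕ} [Fact p.Prime] {N : ℕ} (f : CuspForm (Gamma0 N) 2) (α : ℚ_[p])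

/-! ### Interpolation of the minus `ω^i`-branch at every character of `Γ` -/

section AnyCharacter

/-- **The minus `ω^i`-branch interpolates `ω^i μ⁻_{f,α}` at every character of `Γ`**
(Mazur–Tate–Teitelbaum 1986 §I.13, `L_p(P, χ) = ∫ χ dμ_P` for `P = ω^i μ⁻_{f,α}`): if `μ⁻_{f,α}`
satisfies the distribution relation and is bounded, then for every `m` with `p^{m+1} ≥ p^{e₀}` and
every Dirichlet character `κ` mod `p^{m+1}` with values in `ℂ_p` which is a character of `Γ`,
`∑_k [T^k]L⁻_p(f, α, ω^i, T)·(κ(γ) − 1)^k = ∑_{a mod p^{m+1}} κ(a)·μ⁻_{f,α}(a + p^{m+1}ℤ_p)·ω(a)^i`.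
Twin of `hasSum_padicLBranchCoeff_mul_pow_of_distribution`, same proof.
[cite: MazurTateTeitelbaum1986Invent, §I.13–I.14 (14.3)] -/
theorem hasSum_padicLMinusBranchCoeff_mul_pow_of_distribution
    (hdist : ∀ (n : ℕ) (a : ZMod (p ^ n)),
      ∑ b ∈ Finset.univ.filter (fun b : ZMod (p ^ (n + 1)) ↦
        ZMod.castHom (pow_dvd_pow p n.le_succ) (ZMod (p ^ n)) b = a), msdMinusMeasure f α (n + 1) b =
        msdMinusMeasure f α n a)
    {C : ℝ} (hC : ∀ (n : ℕ) (a : ZMod (p ^ n)), ‖msdMinusMeasure f α n a‖ ≤ C) (i : ℕ) {m : ℕ}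
    (hm : cyclotomicExponent p ≤ m + 1) (κ : DirichletCharacter ℂ_[p] (p ^ (m + 1))) (heven : κ.Even)
    (hord : ∃ j : ℕ, orderOf κ = p ^ j) :
    HasSum (fun k : ℕ ↦ algebraMap ℚ_[p] ℂ_[p] (padicLMinusBranchCoeff f α i k) *
        (κ (cyclotomicGenerator p : ZMod (p ^ (m + 1))) - 1) ^ k)
      (∑ a : ZMod (p ^ (m + 1)), κ a * algebraMap ℚ_[p] ℂ_[p] (msdMinusMeasure f α (m + 1) a *
        teichWeight p i (ZMod.castHom (pow_dvd_pow p hm) (ZMod (p ^ cyclotomicExponent p)) a))) := by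
  have h := hasSum_limUnder_riemannSum_mul_pow_of_distribution
    (μ := branchTwist i (msdMinusMeasure f α)) (RS := padicLMinusBranchRiemannSum f α i)
    (fun k n ↦ weightedRiemannSum_eq (RS := padicLMinusBranchRiemannSum f α i) (fun _ _ ↦ rfl) hdist
      k n)
    (branchTwist_distribution hdist i) (norm_branchTwist_le hC i) κ heven hord
  simp_rw [branchTwist_apply_of_distribution hdist i hm] at h
  exact h

end AnyCharacter

/-! ### Primitive characters of conductor `p^{m+1}`, `m ≥ e₀` -/

section Primitive

/-- The rational minus symbol `[a / p^m]⁻` only depends on `a mod p^m` (`[r + n]⁻ = [r]⁻`,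
`ratMinusSymbol_add_intCast`); twin of `ratPlusSymbol_div_pow_eq_of_castHom`, unconditional.
[cite: MazurTateTeitelbaum1986Invent, §I.4 (4.2)] -/
theorem ratMinusSymbol_div_pow_eq_of_castHom [NeZero N] {m L : ℕ} (h : m ≤ L) (a : ZMod (p ^ L)) :
    ratMinusSymbol f ((a.val : ℚ) / (p : ℚ) ^ m) =
      ratMinusSymbol f (((ZMod.castHom (pow_dvd_pow p h) (ZMod (p ^ m)) a).val : ℚ) /
        (p : ℚ) ^ m) := by
  haveI : NeZero (p ^ L) := ⟨pow_ne_zero _ (Fact.out : p.Prime).ne_zero⟩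
  haveI : NeZero (p ^ m) := ⟨pow_ne_zero _ (Fact.out : p.Prime).ne_zero⟩
  rw [ZMod.castHom_apply, ZMod.cast_eq_val, ZMod.val_natCast]
  have hdiv : a.val % p ^ m + p ^ m * (a.val / p ^ m) = a.val := Nat.mod_add_div _ _
  have hp0 : ((p : ℚ) ^ m) ≠ 0 := pow_ne_zero _ (Nat.cast_ne_zero.mpr (Fact.out : p.Prime).ne_zero)
  have hq : (a.val : ℚ) / (p : ℚ) ^ m =
      ((a.val % p ^ m : ℕ) : ℚ) / (p : ℚ) ^ m + ((a.val / p ^ m : ℕ) : ℚ) := by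
    conv_lhs => rw [← hdiv]
    push_cast
    field_simp
  rw [hq, show ((a.val / p ^ m : ℕ) : ℚ) = (((a.val / p ^ m : ℕ) : ℤ) : ℚ) from
    (Int.cast_natCast _).symm, ratMinusSymbol_add_intCast]

/-- **Evaluation of `ω^i μ⁻_{f,α}` at level `p^{m+1}` against a PRIMITIVE character, `m ≥ e₀`**:
`∑_{a mod p^{m+1}} κ(a)·μ⁻_{f,α}(a + p^{m+1}ℤ_p)·ω(a)^i = α^{−(m+1)} ∑_a κ(a)·ω(a)^i·[a/p^{m+1}]⁻_f` —
the term `α^{−(m+2)}∑_a κ(a)ω(a)^i[a/p^m]⁻` vanishes (`[a/p^m]⁻ω(a)^i` is constant on the fibres of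
`ℤ/p^{m+1} → ℤ/p^m`, on which the coset sums of `κ` vanish, `sum_fiber_eq_zero_of_not_factorsThrough`).
Twin of `sum_mul_msdMeasure_mul_teichWeight_succ` (Mazur–Tate–Teitelbaum 1986 §I.14, proof of (14.3)).
[cite: MazurTateTeitelbaum1986Invent, §I.10 (10.1) and §I.14 (14.3)] -/
theorem sum_mul_msdMinusMeasure_mul_teichWeight_succ [NeZero N] (i : ℕ) {m : ℕ} (hm : cyclotomicExponent p ≤ m)
    (κ : DirichletCharacter ℂ_[p] (p ^ (m + 1))) (hκ : κ.IsPrimitive) :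
    ∑ a : ZMod (p ^ (m + 1)), κ a * algebraMap ℚ_[p] ℂ_[p] (msdMinusMeasure f α (m + 1) a *
        teichWeight p i (ZMod.castHom (pow_dvd_pow p (hm.trans m.le_succ))
          (ZMod (p ^ cyclotomicExponent p)) a)) =
      algebraMap ℚ_[p] ℂ_[p] (α⁻¹ ^ (m + 1)) *
        ∑ a : ZMod (p ^ (m + 1)), κ a *
          algebraMap ℚ_[p] ℂ_[p] (teichWeight p i (ZMod.castHom (pow_dvd_pow p (hm.trans m.le_succ))
            (ZMod (p ^ cyclotomicExponent p)) a)) *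
          (ratMinusSymbol f ((a.val : ℚ) / ((p ^ (m + 1) : ℕ) : ℚ)) : ℂ_[p]) := by
  classical
  haveI : NeZero (p ^ (m + 1)) := ⟨pow_ne_zero _ (Fact.out : p.Prime).ne_zero⟩
  haveI : NeZero (p ^ m) := ⟨pow_ne_zero _ (Fact.out : p.Prime).ne_zero⟩
  set w : ZMod (p ^ (m + 1)) → ℚ_[p] := fun a ↦ teichWeight p i
    (ZMod.castHom (pow_dvd_pow p (hm.trans m.le_succ)) (ZMod (p ^ cyclotomicExponent p)) a) with hw
  -- the weight factors through `ℤ/p^m`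
  have hwfac : ∀ a : ZMod (p ^ (m + 1)), w a = teichWeight p i
      (ZMod.castHom (pow_dvd_pow p hm) (ZMod (p ^ cyclotomicExponent p))
        (ZMod.castHom (pow_dvd_pow p m.le_succ) (ZMod (p ^ m)) a)) := by
    intro a
    rw [hw]
    dsimp only
    rw [castHom_castHom_zmod]
  -- the second term vanishes
  have hvan : ∑ a : ZMod (p ^ (m + 1)),
      κ a * algebraMap ℚ_[p] ℂ_[p] (w a) * (ratMinusSymbol f ((a.val : ℚ) / (p : ℚ) ^ m) : ℂ_[p]) =
        0 := by
    rw [← Finset.sum_fiberwise Finset.univ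
      (ZMod.castHom (pow_dvd_pow p m.le_succ) (ZMod (p ^ m)))]
    refine Finset.sum_eq_zero fun a₀ _ ↦ ?_
    have hconst : ∀ a ∈ Finset.univ.filter (fun a : ZMod (p ^ (m + 1)) ↦
        ZMod.castHom (pow_dvd_pow p m.le_succ) (ZMod (p ^ m)) a = a₀),
        κ a * algebraMap ℚ_[p] ℂ_[p] (w a) * (ratMinusSymbol f ((a.val : ℚ) / (p : ℚ) ^ m) : ℂ_[p]) =
          κ a * (algebraMap ℚ_[p] ℂ_[p] (teichWeight p i
            (ZMod.castHom (pow_dvd_pow p hm) (ZMod (p ^ cyclotomicExponent p)) a₀)) *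
            (ratMinusSymbol f ((a₀.val : ℚ) / (p : ℚ) ^ m) : ℂ_[p])) := by
      intro a ha
      rw [ratMinusSymbol_div_pow_eq_of_castHom f m.le_succ a, hwfac a, (Finset.mem_filter.mp ha).2,
        mul_assoc]
    rw [Finset.sum_congr rfl hconst, ← Finset.sum_mul,
      sum_fiber_eq_zero_of_not_factorsThrough κ _ (not_factorsThrough_of_isPrimitive hκ
        (Nat.pow_lt_pow_right (Nat.Prime.one_lt Fact.out) m.lt_succ_self)) a₀, zero_mul]
  -- the first term
  have hmain : ∀ a : ZMod (p ^ (m + 1)),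
      κ a * algebraMap ℚ_[p] ℂ_[p] (msdMinusMeasure f α (m + 1) a * w a) =
        algebraMap ℚ_[p] ℂ_[p] (α⁻¹ ^ (m + 1)) *
            (κ a * algebraMap ℚ_[p] ℂ_[p] (w a) *
              (ratMinusSymbol f ((a.val : ℚ) / ((p ^ (m + 1) : ℕ) : ℚ)) : ℂ_[p])) -
          algebraMap ℚ_[p] ℂ_[p] (α⁻¹ ^ (m + 2)) *
            (κ a * algebraMap ℚ_[p] ℂ_[p] (w a) *
              (ratMinusSymbol f ((a.val : ℚ) / (p : ℚ) ^ m) : ℂ_[p])) := by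
    intro a
    simp only [msdMinusMeasure, map_sub, map_mul, map_ratCast, Nat.cast_pow, sub_mul]
    ring
  rw [Finset.sum_congr rfl fun a _ ↦ hmain a, Finset.sum_sub_distrib, ← Finset.mul_sum,
    ← Finset.mul_sum, hvan, mul_zero, sub_zero]

/-- **Interpolation of the minus `ω^i`-branch at the PRIMITIVE wild characters** (Mazur–Tate–Teitelbaum
1986 §I.14 (14.3) at the character `κω^i` of conductor `p^{m+1}`): if `μ⁻_{f,α}` is a bounded
distribution, then for every `m ≥ e₀` and every primitive Dirichlet character `κ` of conductor
`p^{m+1}` with values in `ℂ_p` which is a character of `Γ`,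
`L⁻_p(f, α, ω^i, κ(γ) − 1) = α^{−(m+1)} ∑_{a mod p^{m+1}} κ(a) ω(a)^i [a/p^{m+1}]⁻_f`.
[cite: MazurTateTeitelbaum1986Invent, §I.13–I.14 (14.3)] -/
theorem hasSum_padicLMinusBranchCoeff_mul_pow_of_isPrimitive [NeZero N]
    (hdist : ∀ (n : ℕ) (a : ZMod (p ^ n)),
      ∑ b ∈ Finset.univ.filter (fun b : ZMod (p ^ (n + 1)) ↦
        ZMod.castHom (pow_dvd_pow p n.le_succ) (ZMod (p ^ n)) b = a), msdMinusMeasure f α (n + 1) b =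
        msdMinusMeasure f α n a)
    {C : ℝ} (hC : ∀ (n : ℕ) (a : ZMod (p ^ n)), ‖msdMinusMeasure f α n a‖ ≤ C) (i : ℕ) {m : ℕ}
    (hm : cyclotomicExponent p ≤ m) (κ : DirichletCharacter ℂ_[p] (p ^ (m + 1))) (hκ : κ.IsPrimitive)
    (heven : κ.Even) (hord : ∃ j : ℕ, orderOf κ = p ^ j) :
    HasSum (fun k : ℕ ↦ algebraMap ℚ_[p] ℂ_[p] (padicLMinusBranchCoeff f α i k) *
        (κ (cyclotomicGenerator p : ZMod (p ^ (m + 1))) - 1) ^ k)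
      (algebraMap ℚ_[p] ℂ_[p] (α⁻¹ ^ (m + 1)) *
        ∑ a : ZMod (p ^ (m + 1)), κ a *
          algebraMap ℚ_[p] ℂ_[p] (teichWeight p i (ZMod.castHom (pow_dvd_pow p (hm.trans m.le_succ))
            (ZMod (p ^ cyclotomicExponent p)) a)) *
          (ratMinusSymbol f ((a.val : ℚ) / ((p ^ (m + 1) : ℕ) : ℚ)) : ℂ_[p])) := by
  rw [← sum_mul_msdMinusMeasure_mul_teichWeight_succ f α i hm κ hκ]
  exact hasSum_padicLMinusBranchCoeff_mul_pow_of_distribution f α hdist hC i (hm.trans m.le_succ) κ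
    heven hord

/-- **The minus `ω^i`-branches are bounded** when `μ⁻_{f,α}` is a bounded distribution:
`‖[T^k]L⁻_p(f, α, ω^i, T)‖ ≤ C` (Mazur–Tate–Teitelbaum 1986 §I.12: the branches lie in `Λ ⊗ ℚ_p`;
the tree's `norm_padicLMinusBranchCoeff_le` through `coeff_padicLFunctionMinusBranch`).
[cite: MazurTateTeitelbaum1986Invent, §I.12–I.13] -/
theorem norm_coeff_padicLFunctionMinusBranch_le
    (hdist : ∀ (n : ℕ) (a : ZMod (p ^ n)),
      ∑ b ∈ Finset.univ.filter (fun b : ZMod (p ^ (n + 1)) ↦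
        ZMod.castHom (pow_dvd_pow p n.le_succ) (ZMod (p ^ n)) b = a), msdMinusMeasure f α (n + 1) b =
        msdMinusMeasure f α n a)
    {C : ℝ} (hC : ∀ (n : ℕ) (a : ZMod (p ^ n)), ‖msdMinusMeasure f α n a‖ ≤ C) (i k : ℕ) :
    ‖PowerSeries.coeff k (padicLFunctionMinusBranch f α i)‖ ≤ C := by
  rw [coeff_padicLFunctionMinusBranch]
  exact norm_padicLMinusBranchCoeff_le f α hdist hC i k

end Primitive

end Literature.NumberTheory.EllipticCurves

end
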